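import Literature.Probability.Percolation.IntRawGoodUp
import Literature.Probability.Percolation.IntTermFence
import HarnessLib

/-!
# The fence of a term explored from above, at an internal extremity (twin of `TrapTermFenceUp.lean`)

Topic `Literature/Probability/Percolation`; family `crit-perc` / near-critical percolation on `𝕋`.
A brick of the INNER half of the near-critical arm-separation theorem for four arms in the ADJACENT
colour arrangement (P. Nolin, EJP 13 (2008), Thm. 11, `j = 4`, `σ = BBWW` [arXiv 0711.4948:
Thm. 10], §4.4 Lemma 15, internal extremities). Mirror of `IntTermFence.lean` for the terms of the
inner exploration from above (`(intDom m).flip`), whose fences (`IntFrameBelow.lean`) sit in the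
lower corner box inside `Λ_m` and whose connections run in `flip.above d z` on the half-annulus and
strictly below the row of the tip inside `Λ_m`:

* `intFenceSetUp m d z k ω S` and its membership lemmas; `IntTermFenceUp m d z k ω S` (the data);
  `IntRawOKUp.nonempty_intTermFenceUp`;
* `IntTermFenceUp.norm_m'_succ_le`, `IntTermFenceUp.exists_exit_up`; `tipSide_of_adj_inner` (a half-annulus site of norm `m` in the
  box about a middle tip lies on the tip side or on the lower side); `IntTermFenceUp.exit_mem_Jbelow`
  (the last half-annulus site before entering `Λ_m` is on the tip arc strictly BELOW the tip) and
  `IntTermFence.exit_mem_Jabove` (for fences from below: strictly ABOVE the tip);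
  `IntTermFenceUp.row_le`.

Everything here is proved; no named facts are introduced.

## References

* P. Nolin, Near-critical percolation in two dimensions, *Electron. J. Probab.* 13 (2008), §4.4,
  proof of Lemma 15, internal extremities (arXiv 0711.4948: Lemma 14; Thm. 10 p. 13) [Nolin2008].
* H. Kesten, *Percolation theory for mathematicians* (1982), §2.3 [KestenPTM1982].
-/

noncomputable section

open Set

namespace Literature.Probability.Percolation

open LatticeModels HalfAnnulus

/-! ### The admissible sites of a fence from above -/

/-- **The admissible sites of the connection of the inner fence of a term `d` from above stopped at `S`.** [cite: Nolin2008, §4.4 Lemma 15 (proof), internal extremities (arXiv 0711.4948: Lemma 14)] -/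
def intFenceSetUp (m : ℕ) (d : Finset (Site 2)) (z : Site 2) (k : ℕ) (ω : SiteConfig (Site 2)) (S : Set (Site 2)) : Set (Site 2) :=
  (intFrameZoneBelow m z k ∩
    {v | ((m : ℤ) ≤ triNorm v → v ∈ (intDom m).flip.above d z) ∧ (triNorm v < m → v 1 < z 1)}) ∩ ω ∩ Sᶜ

section FenceSetUp

variable {m k : ℕ} {d : Finset (Site 2)} {z : Site 2} {ω : SiteConfig (Site 2)} {S : Set (Site 2)} {v : Site 2}

/-- Sites of the fence set are open. [folklore] -/
theorem intFenceSetUp_subset : intFenceSetUp m d z k ω S ⊆ ω := fun _ hv => hv.1.2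

/-- Sites of the fence set are off `S`. [folklore] -/
theorem intFenceSetUp_disjoint (hv : v ∈ intFenceSetUp m d z k ω S) : v ∉ S := hv.2

/-- Sites of the fence set lie in the square of half-width `2k + 1` about `z`. [folklore] -/
theorem intFenceSetUp_box (hv : v ∈ intFenceSetUp m d z k ω S) :
    z 0 - (2 * k + 1) ≤ v 0 ∧ v 0 ≤ z 0 + (2 * k + 1) ∧ z 1 - (2 * k + 1) ≤ v 1 ∧ v 1 ≤ z 1 + (2 * k + 1) :=
  (mem_intFrameZoneBelow.1 hv.1.1.1).2

/-- A half-annulus site of the fence set is a site of the domain in `flip.above d z`, off `d`. [folklore] -/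
theorem mem_intFenceSetUp_inside (hv : v ∈ intFenceSetUp m d z k ω S) (hn : (m : ℤ) ≤ triNorm v) :
    v ∈ haFin m ∧ v ∈ (intDom m).flip.above d z ∧ v ∉ d := by
  have ha := hv.1.1.2.1 hn
  have hT : v ∈ haFin m := by
    rcases (mem_intFrameZoneBelow.1 hv.1.1.1).1 with h | h
    · rw [← coe_haFin] at h; exact Finset.mem_coe.1 h
    · have := (mem_hinSet.1 h.1).2; omega
  exact ⟨hT, ha, fun hvd => JDomain.not_mem_of_mem_above ha hvd⟩

/-- A site of the fence set inside `Λ_m` lies strictly below the row of `z`. [folklore] -/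
theorem mem_intFenceSetUp_beyond (hv : v ∈ intFenceSetUp m d z k ω S) (hn : triNorm v < m) : v 1 < z 1 := hv.1.1.2.2 hn

end FenceSetUp

/-! ### The data -/

/-- **An inner fence of the term `d` from above (tip `z`, scale `k`) stopped at `S`** in `ω`. [cite: Nolin2008, §4.4 Lemma 15 (proof), internal extremities (arXiv 0711.4948: Lemma 14)] -/
structure IntTermFenceUp (m : ℕ) (d : Finset (Site 2)) (z : Site 2) (k : ℕ) (ω : SiteConfig (Site 2)) (S : Set (Site 2)) where
  /-- the fence site, inside `Λ_m` -/
  m' : Site 2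
  /-- the attachment site, in `S` -/
  q : Site 2
  /-- the first site of the connection, a neighbour of `q` -/
  p : Site 2
  /-- the sites of the connection -/
  F : Set (Site 2)
  vcross : OpenVCrossThrough (triStrip (z 0 - 2 * k) (z 1 - 2 * k) k k) (z 1 - 2 * k) (z 1 - k) ω m'
  q_mem : q ∈ S
  adj : triGraph.Adj q p
  F_subset : F ⊆ intFenceSetUp m d z k ω S
  path : PathIn triGraph F p m'
  tight : ∀ x ∈ F, PathIn triGraph F p x

namespace IntTermFenceUp

variable {m k : ℕ} {d : Finset (Site 2)} {z : Site 2} {ω : SiteConfig (Site 2)} {S : Set (Site 2)}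
  (T : IntTermFenceUp m d z k ω S)

/-- The fence site is inside `Λ_m` (`1 ≤ k`, middle tip); `m' ∈ F` is `T.path.right_mem` and every
site `x ∈ F` is joined to `m'` by `(T.tight x hx).symm.trans T.path`. [folklore] -/
theorem norm_m'_succ_le (hk : 1 ≤ k) (hz : IsIntJ m z) (htk : -(m : ℤ) + 2 * k + 1 ≤ z 1 ∧ z 1 ≤ -(2 * (k : ℤ) + 1)) :
    triNorm T.m' + 1 ≤ m := by
  obtain ⟨e₁, e₂, -, -, hp, -⟩ := T.vcross
  have hm := (hp.right_mem).1
  rw [mem_triStrip] at hm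
  obtain ⟨hz0, hz1, hz2⟩ := hz
  have hk' : (1 : ℤ) ≤ k := by exact_mod_cast hk
  rw [triNorm_eq_max]; omega

/-- **Following the connection of a fence from above into `Λ_m`.** [folklore] -/
theorem exists_exit_up (hk : 1 ≤ k) (hz : IsIntJ m z) (htk : -(m : ℤ) + 2 * k + 1 ≤ z 1 ∧ z 1 ≤ -(2 * (k : ℤ) + 1)) {x : Site 2}
    (hx : x ∈ T.F) (hxn : (m : ℤ) ≤ triNorm x) :
    ∃ x' e : Site 2, triNorm e < m ∧ (m : ℤ) ≤ triNorm x' ∧ e ∈ T.F ∧ triGraph.Adj x' e ∧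
      PathIn triGraph ({v | (m : ℤ) ≤ triNorm v} ∩ T.F) x x' := by
  have hm := T.norm_m'_succ_le hk hz htk
  obtain ⟨x', e, hx', he, heF, hadj, hpath⟩ :=
    ((T.tight x hx).symm.trans T.path).exit (R := {v : Site 2 | (m : ℤ) ≤ triNorm v}) hxn (by simp only [Set.mem_setOf_eq, not_le]; omega)
  simp only [Set.mem_setOf_eq, not_le] at hx' he
  exact ⟨x', e, he, hx', heF, hadj, hpath⟩

end IntTermFenceUp

/-- **A half-annulus site of norm `m` in the box about a middle tip (strictly more than `2k + 1`
rows above the lower corner), next to a site inside `Λ_m`, lies on the tip side `x₀ = m`.** [folklore] -/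
theorem tipSide_of_adj_inner {m k : ℕ} {z v e : Site 2} (hk : 1 ≤ k) (hz : IsIntJ m z)
    (htk : -(m : ℤ) + (2 * k + 1) < z 1 ∧ z 1 ≤ -(2 * (k : ℤ) + 1)) (hn : triNorm v = m)
    (hbox : z 0 - (2 * k + 1) ≤ v 0 ∧ v 0 ≤ z 0 + (2 * k + 1) ∧ z 1 - (2 * k + 1) ≤ v 1 ∧ v 1 ≤ z 1 + (2 * k + 1))
    (hen : triNorm e < m) (hadj : triGraph.Adj v e) : v 0 = m := by
  obtain ⟨hz0, hz1, hz2⟩ := hz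
  have hk' : (1 : ℤ) ≤ k := by exact_mod_cast hk
  have hve := (triGraph_adj_iff_coord v e).1 hadj
  have hn' := hn
  have hen' := hen
  rw [triNorm_eq_max] at hn' hen'
  rcases hve with h | h | h | h | h | h <;> omega

namespace IntTermFenceUp

variable {m k : ℕ} {d : Finset (Site 2)} {z : Site 2} {ω : SiteConfig (Site 2)} {S : Set (Site 2)}
  (T : IntTermFenceUp m d z k ω S)

/-- **The last half-annulus site before entering `Λ_m` is on the tip arc strictly BELOW the tip**
(and within `2k + 1` rows of it), for a fence from above of a middle tip strictly more than `2k + 1` rows above the lower corner (`m ≥ 5`). [cite: KestenPTM1982, §2.3] -/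
theorem exit_mem_Jbelow (hm : 5 ≤ m) (hk : 1 ≤ k) (hd : (intDom m).flip.IsCrossing d z)
    (htk : -(m : ℤ) + (2 * k + 1) < z 1 ∧ z 1 ≤ -(2 * (k : ℤ) + 1))
    {x' e : Site 2} (hx'F : x' ∈ T.F) (hx'n : (m : ℤ) ≤ triNorm x') (hen : triNorm e < m) (hadj : triGraph.Adj x' e) :
    x' 0 = m ∧ z 1 - (2 * k + 1) ≤ x' 1 ∧ x' 1 < z 1 := by
  have hcutf : (intDom m).flip.CutProp := JDomain.flip_cutProp (intDom_cutProp hm)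
  have hd' : (intDom m).IsCrossing d z := (JDomain.flip_isCrossing_iff _).1 hd
  have hz := tip_isIntJ hd'
  obtain ⟨hx'D, hx'a, hx'd⟩ := mem_intFenceSetUp_inside (T.F_subset hx'F) hx'n
  have hbox := intFenceSetUp_box (T.F_subset hx'F)
  have hx'b : triNorm x' = m := by have := triNorm_le_triNorm_add_one_of_adj hadj.symm; omega
  have hx'0 : x' 0 = m := tipSide_of_adj_inner hk hz htk hx'b hbox hen hadj
  have hne : x' ≠ z := fun h => hx'd (h ▸ hd.tip_mem)
  obtain ⟨hz0, hz1, hz2⟩ := hz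
  rcases int_sType_or_nType hx'D hx'b (Or.inl hx'0) hd'.tip_mem_J hne with hS | hN
  · simp only [Finset.mem_union, mem_intDom_Bt, JDomain.mem_Jbelow, mem_intDom_J] at hS
    rcases hS with ⟨-, -, hB⟩ | ⟨-, hlt⟩
    · rcases hB with h | ⟨-, h⟩ <;> exact ⟨hx'0, by omega, by omega⟩
    · exact ⟨hx'0, by omega, by simpa using hlt⟩
  · exfalso
    refine hd.not_mem_above_of_mem_Bt_union hcutf ?_ hx'a
    rwa [JDomain.flip_Bt, JDomain.flip_Jbelow]

/-- Bookkeeping: every site of the connection lies at most `2k + 1` rows above `z`. [folklore] -/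
theorem row_le {x : Site 2} (hx : x ∈ T.F) : x 1 ≤ z 1 + (2 * k + 1) := (intFenceSetUp_box (T.F_subset hx)).2.2.2

end IntTermFenceUp

/-- **The last half-annulus site before entering `Λ_m` of a fence from below is on the tip arc
strictly ABOVE the tip** (and within `2k + 1` rows of it), for a middle tip strictly more than `2k + 1` rows above the lower corner (`m ≥ 5`). [cite: KestenPTM1982, §2.3] -/
theorem IntTermFence.exit_mem_Jabove {m k : ℕ} {c : Finset (Site 2)} {z : Site 2} {ω : SiteConfig (Site 2)} {S : Set (Site 2)}
    (T : IntTermFence m c z k ω S) (hm : 5 ≤ m) (hk : 1 ≤ k) (hc : (intDom m).IsCrossing c z)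
    (htk : -(m : ℤ) + (2 * k + 1) < z 1 ∧ z 1 ≤ -(2 * (k : ℤ) + 1))
    {x' e : Site 2} (hx'F : x' ∈ T.F) (hx'n : (m : ℤ) ≤ triNorm x') (hen : triNorm e < m) (hadj : triGraph.Adj x' e) :
    x' 0 = m ∧ z 1 < x' 1 ∧ x' 1 ≤ z 1 + (2 * k + 1) := by
  have hcut := intDom_cutProp hm
  have hz := tip_isIntJ hc
  obtain ⟨hx'D, hx'a, hx'c⟩ := mem_intFenceSet_inside (T.F_subset hx'F) hx'n
  have hbox := intFenceSet_box (T.F_subset hx'F)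
  have hx'b : triNorm x' = m := by have := triNorm_le_triNorm_add_one_of_adj hadj.symm; omega
  have hx'0 : x' 0 = m := tipSide_of_adj_inner hk hz htk hx'b hbox hen hadj
  have hne : x' ≠ z := fun h => hx'c (h ▸ hc.tip_mem)
  obtain ⟨hz0, hz1, hz2⟩ := hz
  rcases int_sType_or_nType hx'D hx'b (Or.inl hx'0) hc.tip_mem_J hne with hS | hN
  · exact absurd hx'a (hc.not_mem_above_of_mem_Bt_union hcut hS)
  · have h1 := int_row_lt_of_nType hc.tip_mem_J hN hx'0 hne
    exact ⟨hx'0, h1, by omega⟩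

/-! ### Existence from raw success -/

/-- **A raw-good term from above has an inner fence stopped at any `S ⊇ d` of half-annulus sites.** [cite: Nolin2008, §4.4 Lemma 15 (proof), internal extremities (arXiv 0711.4948: Lemma 14)] [cite: Kesten1987, Lemma 2] -/
theorem IntRawOKUp.nonempty_intTermFenceUp {m k : ℕ} {d : Finset (Site 2)} {z : Site 2} {ω : SiteConfig (Site 2)}
    (h : IntRawOKUp m d z k ω) (hm : 5 ≤ m) (hk : 1 ≤ k) (hd : (intDom m).flip.IsCrossing d z)
    (htk : -(m : ℤ) + 2 * k + 1 ≤ z 1 ∧ z 1 ≤ -(2 * (k : ℤ) + 1)) {S : Set (Site 2)} (hdS : (↑d : Set (Site 2)) ⊆ S)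
    (hSn : ∀ v ∈ S, (m : ℤ) ≤ triNorm v) : Nonempty (IntTermFenceUp m d z k ω S) := by
  obtain ⟨m', hV, q, hqS, p, hqp, hpath⟩ := h.exists_fence_below_gen hm hk hd htk hdS hSn
  obtain ⟨F, hF, hp, ht⟩ := hpath.exists_support
  exact ⟨{ m' := m', q := q, p := p, F := F, vcross := hV, q_mem := hqS, adj := hqp, F_subset := hF, path := hp, tight := ht }⟩

end Literature.Probability.Percolation
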